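import Summits.QuantumFields.YangMills.Theorems.BalabanUVNodesN15TwoSpacingGluingCurvedKnitSmallFieldGradientDefect
import Summits.QuantumFields.YangMills.Theorems.BalabanUVNodesN15TwoSpacingGluingCurvedKnitSmallFieldGradient
import Summits.QuantumFields.YangMills.Theorems.BalabanUVNodesN15TwoSpacingGluingCurvedKnitSmallFieldPair
import Summits.QuantumFields.YangMills.Theorems.BalabanUVNodesN15BackgroundCovariantEntries
import HarnessLib

/-!
# THE GLUING STEP AT TWO LATTICE SPACINGS — THE GRADIENT ENTRIES OF THE GLUED LIVE-BACKGROUND PROPAGATOR, X: THE COVARIANT EDITION — the two-spacing η-defect of Bałaban's COVARIANT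
# forward gradient `D^η_{R,μ}𝒢 = M_{R⁺_μ}∘(∇⁺_μ𝒢) + M_{a⁺_μ}𝒢` (n15-b `covD`, (3.50)–(3.52)) of the live glued propagators in the global small-field gauge — the (3.42) entry `∇_UG` of the model family,
# every row discharged (dag-n15-c g17, FILE 144; N15 = NE2, s1 «background-layer OPERATOR ingredient»)

Cell `pub-ymgap`, seat `pub-ymgap-dag-n15-c` (R134 (a); HUMAN RULING D-0062), generation 17.  `bears_on: R4∕N15 · K3⁸ SpineGivenEndpointR13SepCoPHV (stmt-QuantumFields-27366)`.
Filed `--kind proof --supports stmt-QuantumFields-27366 --as helper` — COUNT-NEUTRAL.  Theorems only; 0 `def`, 0 `sorry`.  Imports BY NAME FILE 139 `…CurvedKnitSmallFieldGradientDefect`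
(`sf_idef_jet_cvGlued`), FILE 143 `…CurvedKnitSmallFieldGradient` (`sf_jet_cvGlued_spec`), FILE 133 `…CurvedKnitSmallFieldPair` (`sf_cvGlued_pair_spec`; through it FILE 130 `sf_idef_cvGlued`,
`gavgM_conjTranspose_of_skew`, dag-n15-w2 `twoSidedLetters_curvCoef_one_of_meanGauge`, `curvCoefA_one`, `expTrField`, `Phi0_adCLM_eq_mulLeftRight`, `conjTranspose_exp_smul_of_conjTranspose`)
and n15-b `…BackgroundCovariantEntries` (`hasMaj_idef_mmulOp_comp_left`: the diagonal Leibniz letter; through it `covD`, `fdiffN_liftMap_eq_fgrad`, `tCoefA_inl`).  Nothing in the tree is modified.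

WHY.  Entry 1 of [Balaban1985BackgroundPropagators] (3.42) p. 397 is the COVARIANT gradient `∇_UG(U)`.  In n15-b's vocabulary the covariant forward difference along `τ_μ` with transport `R⁺_μ`
is `covD η R⁺_μ τ_μ = M_{R⁺_μ} ∘ fdiffN η + M_{η⁻¹(R⁺_μ − 1)}` ((3.50) p. 400), i.e. `M_{R⁺_μ}∘∇⁺_μ + M_{a⁺_μ}` with the EXACT first-order coefficient `a⁺_μ = tCoefA η R (inl μ)` ((3.51)–(3.52)).
Hence `D^η_{R,μ}∘𝒢 = M_R∘(∇⁺_μ𝒢) + M_a∘𝒢` and its two-spacing η-defect is two DIAGONAL LEIBNIZ LETTERS (n15-b `hasMaj_idef_mmulOp_comp_left`: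
`𝔇(M_{C′}E′, M_CE) ≤ (α·m + o·β_E)e^{−ρd}`): the `R`-term with `E = ∇⁺_μ𝒢` (η-defect FILE 139, coarse one-grid bound FILE 143, rows `1 + η′·scale` and fit `η′·scale·η + (η − η′)·scale` of
`R = 1 + η·a`), the `a`-term with `E = 𝒢` (η-defect FILE 130, one-grid bound FILE 133, rows `scale` = letter 2 and fit `scale·η` = letter 6 of the fifteen `TwoSidedLetters`).

WHAT.  §1 `exp_eq_expTrField` (the transporter field of `U = e^{ηA}` IS `expTrField e η (ad∘A)` for skew `A` — 130's lemma without the `1·U·1ᴴ` sandwich), `transport_inl_eq` (`R⁺_μ = 1 + η·a⁺_μ`),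
`covD_transport_inl` (`D^η_{R⁺_μ} = M_{R⁺_μ}∘∇⁺_μ + M_{a⁺_μ}`), `rowSum_one_add_smul_le`, `rowFit_one_add_smul_le` (rows ∕ fit of `1 + η·a`).  §2 ★★★ `sf_idef_covD_cvGlued`: for odd `L ≥ 7`,
`a > 0`, `ι`: `∃ δ w₀ R₀ D` such that for every `(m, k ≥ 1, r)`, every direction `μ`, every skew-Hermitian fine potential `A′` in the C² window (FILE 130's hypotheses):
`𝔇_π̂(D^{η′}_{R′⁺_μ} ∘ cvGlued′ … 1 e^{η′A′} (N′_L ⊗ 1) 0, D^η_{R⁺_μ} ∘ cvGlued … 1 e^{ηĀ′} (N_L ⊗ 1) 0) ≤ D·((L^k)^{−1∕16} + scale·(1+|J⊕J|)·η)·e^{−δ|y−y′|}` blockwise — the COVARIANT gradient entry of the live pair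
with NO displayed row, `D = (1 + R₀)·max D_J 0 + 2B₁ + R₀·max D₀ 0 + B_P`.

HONEST FRAMING ∕ LIMITS.  Assembly of LANDED theorems + matrix row-sum bookkeeping; MODEL operator (covariant Laplacian (3.50) ⊗ colour + FLAT nonlocal part (1.69) — NOT Bałaban's `Δ_a(U)` (3.26));
MODEL class (global gauge; C² window incl. all mixed second differences) ∕ pairing (King block mean) ∕ carriers (doubled-torus cover); the FORWARD covariant gradient only (the backward one is the
`inr` twin with signs; the right-composed entry `𝒢∇*_U` of (3.42) is NOT here); constants crude.  The η-RATE inequality is NOT PRINTED ([B9] Thm 3.14 = domain differences); nothing of [B5]∕[B6]∕[B9]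
asserted.  NE2⁺ NOT PRINTED, NOT proved; N15 NOT discharged; K3⁸ OPEN, skeleton v6 untouched (0∕2); counts of record UNMOVED (typed 28∕28 · discharged 5∕27 · A 5∕28); one finite 𝕋⁴ at fixed ε — NOT
infinite volume, NOT OS on ℝ⁴, NOT a mass gap, NOT Clay; R4 closes the conditional finite-𝕋⁴ rung `BalabanLadder.UV` only.  Restate-immune (no Theses import).
-/

noncomputable section

open scoped BigOperators Matrix Matrix.Norms.Frobenius

namespace Summit.QuantumFields.YangMills.BalabanUVNodes.N15.Gluing

open Literature.MathematicalPhysics.QuantumFieldTheory.Balaban1983to89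
open Literature.MathematicalPhysics.QuantumFieldTheory.Balaban1983to89.B11SectG (BlockNorm HasMaj)
open Literature.MathematicalPhysics.QuantumFieldTheory.Balaban1983to89.T4EtaRateDefect (idef idef_add)
open Literature.MathematicalPhysics.QuantumFieldTheory.Balaban1983to89.T4EtaRateCoeffDefect (pull)
open Literature.MathematicalPhysics.QuantumFieldTheory.Balaban1983to89.B6Prop26Gluing (mulOp)
open Literature.MathematicalPhysics.QuantumFieldTheory.Balaban1983to89.B6UnitTorusCarrier (unitTorusGeo unitTorusGeo_dist_nonneg)
open Literature.MathematicalPhysics.QuantumFieldTheory.Balaban1983to89.B5Prop11Plancherel (Tor)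
open Literature.MathematicalPhysics.QuantumFieldTheory.King1986.Torus (blockOf)
open Literature.Barriers.QuantumFields (traceForm)
open Literature.MathematicalPhysics.QuantumFieldTheory.Balaban1983to89.Beta.AveragingCorrectionJets (adCLM)
open Summit.QuantumFields.YangMills.BalabanUVNodes.N15.BackgroundLayer (covLapM tCoefA tCoefC tCoefA_inl gavgM fgrad bgrad fdiffN_liftMap_eq_fgrad hasMaj_idef_mmulOp_comp_left)
open Summit.QuantumFields.YangMills.BalabanUVNodes.N15.VectorPiece (bshiftEquiv kingPrV kingPrV_bshiftEquiv_pow fibre_conn_kingPrV bshiftEquiv_comm)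
open Summit.QuantumFields.YangMills.BalabanUVNodes.N15.MatrixSpecies (mmulOp coordMat basisConst basisConst_nonneg liftBlk liftMap liftEquiv covD)
open Summit.QuantumFields.YangMills.BalabanUVNodes.N15.CurvedSpecies (gaugePair gaugePair_inl expTrField expTrField_apply curvCoefA_one twoSidedLetters_curvCoef_one_of_meanGauge
  coordMat_adCLM_transpose_eq_neg_of_conjTranspose Phi0_adCLM_eq_mulLeftRight conjTranspose_exp_smul_of_conjTranspose)

variable {d : ℕ}

/-! ## §1 The covariant difference as `M_R∘∇ + M_a`; rows and fit of `R = 1 + η·a`; the transporter field of `e^{ηA}` -/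

section Rows

variable {ι : Type} [Fintype ι] [DecidableEq ι]

/-- Rows of `1 + η·a`: `Σ_j|(1 + η·a)_{ij}| ≤ 1 + η·α` from `Σ_j|a_{ij}| ≤ α`, `η ≥ 0`. [folklore] -/
theorem rowSum_one_add_smul_le {a : Matrix ι ι ℝ} {α η : ℝ} (hη : 0 ≤ η) {i : ι} (ha : ∑ j, |a i j| ≤ α) : ∑ j, |(1 + η • a) i j| ≤ 1 + η * α := by
  calc ∑ j, |(1 + η • a) i j| ≤ ∑ j, (|(1 : Matrix ι ι ℝ) i j| + η * |a i j|) := Finset.sum_le_sum fun j _ => by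
          rw [Matrix.add_apply, Matrix.smul_apply, smul_eq_mul]
          exact (abs_add_le _ _).trans (by rw [abs_mul, abs_of_nonneg hη])
    _ = ∑ j, |(1 : Matrix ι ι ℝ) i j| + η * ∑ j, |a i j| := by rw [Finset.sum_add_distrib, Finset.mul_sum]
    _ ≤ 1 + η * α := by
          have h1 : ∑ j, |(1 : Matrix ι ι ℝ) i j| = 1 := by
            simp only [Matrix.one_apply]
            rw [Finset.sum_eq_single i (fun j _ hji => by rw [if_neg (Ne.symm hji), abs_zero]) (fun h => absurd (Finset.mem_univ i) h), if_pos rfl, abs_one]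
          rw [h1]
          linarith [mul_le_mul_of_nonneg_left ha hη]

/-- Fit of `1 + η′·a′` against `1 + η·b`: `≤ η′·o + |η′ − η|·α` from `Σ_j|a′_{ij} − b_{ij}| ≤ o`, `Σ_j|b_{ij}| ≤ α`, `η′ ≥ 0`. [folklore] -/
theorem rowFit_one_add_smul_le {a' b : Matrix ι ι ℝ} {α o η η' : ℝ} (hη' : 0 ≤ η') {i : ι} (hb : ∑ j, |b i j| ≤ α) (hfit : ∑ j, |a' i j - b i j| ≤ o) :
    ∑ j, |(1 + η' • a') i j - (1 + η • b) i j| ≤ η' * o + |η' - η| * α := by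
  calc ∑ j, |(1 + η' • a') i j - (1 + η • b) i j| ≤ ∑ j, (η' * |a' i j - b i j| + |η' - η| * |b i j|) := Finset.sum_le_sum fun j _ => by
          rw [Matrix.add_apply, Matrix.add_apply, Matrix.smul_apply, Matrix.smul_apply, smul_eq_mul, smul_eq_mul,
            show (1 : Matrix ι ι ℝ) i j + η' * a' i j - ((1 : Matrix ι ι ℝ) i j + η * b i j) = η' * (a' i j - b i j) + (η' - η) * b i j by ring]
          exact (abs_add_le _ _).trans (by rw [abs_mul, abs_mul, abs_of_nonneg hη'])
    _ = η' * ∑ j, |a' i j - b i j| + |η' - η| * ∑ j, |b i j| := by rw [Finset.sum_add_distrib, Finset.mul_sum, Finset.mul_sum]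
    _ ≤ η' * o + |η' - η| * α := add_le_add (mul_le_mul_of_nonneg_left hfit hη') (mul_le_mul_of_nonneg_left hb (abs_nonneg _))

variable {X J : Type} (τ : J → X ≃ X)

omit [Fintype ι] in
/-- `R⁺_μ = 1 + η·a⁺_μ` with the exact coefficient `a⁺_μ = tCoefA η R (inl μ) = η⁻¹(R⁺_μ − 1)` (`η ≠ 0`). [cite: Balaban1985BackgroundPropagators, (3.51)–(3.52) p.400] -/
theorem transport_inl_eq (S : J → X → Matrix ι ι ℝ) (η : ℝ) (hη : η ≠ 0) (μ : J) (x : X) :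
    gaugePair τ S (Sum.inl μ) x = 1 + η • tCoefA η (gaugePair τ S) (Sum.inl μ) x := by
  rw [tCoefA_inl, smul_smul, mul_inv_cancel₀ hη, one_smul, add_sub_cancel]

/-- ★ `D^η_{R⁺_μ} = M_{R⁺_μ}∘∇⁺_μ + M_{a⁺_μ}`: n15-b's covariant difference is the transport sandwich of the flat forward quotient plus the exact first-order coefficient.
[cite: Balaban1985BackgroundPropagators, (3.50)–(3.52) p.400] -/
theorem covD_transport_inl (η : ℝ) (R : J ⊕ J → X → Matrix ι ι ℝ) (μ : J) :
    covD η (R (Sum.inl μ)) (τ μ) = mmulOp (R (Sum.inl μ)) ∘ₗ fgrad η⁻¹ (liftEquiv (τ μ) ι) + mmulOp (tCoefA η R (Sum.inl μ)) := by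
  unfold covD
  rw [fdiffN_liftMap_eq_fgrad]
  rfl

variable {mm : Type} [Fintype mm] [DecidableEq mm] (e : Matrix mm mm ℂ ≃L[ℝ] (ι → ℝ))

/-- ★ The transporter field of `U = e^{ηA}` (skew `A`) IS `expTrField e η (ad∘A)` (FILE 130's `conj_one_exp_eq_expTrField` without the `1·U·1ᴴ` sandwich).
[cite: Balaban1985BackgroundPropagators, (3.37) p.396, (3.50) p.400 (shape)] -/
theorem exp_eq_expTrField {X J : Type} (η : ℝ) {A : J → X → Matrix mm mm ℂ} (hA : ∀ μ x, (A μ x)ᴴ = -A μ x) :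
    (fun μ x => coordMat e (ContinuousLinearMap.mulLeftRight ℝ (Matrix mm mm ℂ) (NormedSpace.exp (η • A μ x)) (NormedSpace.exp (η • A μ x))ᴴ)) = expTrField e η (fun μ x => adCLM ℝ (A μ x)) := by
  funext μ x
  rw [expTrField_apply, Phi0_adCLM_eq_mulLeftRight, conjTranspose_exp_smul_of_conjTranspose (hA μ x)]
  rfl

end Rows

/-! ## §2 The two-spacing η-defect of the covariant forward gradient of the live glued propagators, every row produced -/

section Defect

variable {L : ℕ} [NeZero L]

set_option maxHeartbeats 800000 in
/-- ★★★ **THE η-DEFECT OF THE COVARIANT FORWARD GRADIENT `D^η_{R⁺_μ}𝒢` OF THE LIVE-BACKGROUND GLUED PROPAGATORS AT THE COVER IN THE GLOBAL SMALL-FIELD GAUGE, EVERY ROW PRODUCED.**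
For odd `L ≥ 7`, `a > 0`, a colour index `ι`: `∃ δ, R₀ > 0`, `w₀`, `D` such that on every doubled torus `2L·L^m` of the cover (`k ≥ 1`, `L^m ≥ w₀`), every refinement `r`, every direction
`μ`, for trace-form coordinates `e` and EVERY skew-Hermitian fine potential `A′` in the C² window at scale `r_A` (`2(2+d)(5+2d)r_A ≤ 1`, `scale·(1+|J⊕J|) ≤ R₀`): the η-defect along
King's pairing of `D^{η′}_{R′⁺_μ} ∘ cvGlued′ … 1 e^{η′A′} (N′_L ⊗ 1) 0` against `D^η_{R⁺_μ} ∘ cvGlued … 1 e^{ηĀ′} (N_L ⊗ 1) 0` (`R = coordMat e Ad_{e^{ηĀ′}}` paired by `gaugePair`, `Ā′ = gavgM π̂ A′`) is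
`≤ D·((L^k)^{−1∕16} + scale·(1+|J⊕J|)·η)·e^{−δ|y−y′|}` blockwise.  MODEL operator ∕ class ∕ pairing ∕ carriers; NOT [B9] Thm 3.14 and not any printed estimate.
[cite: Balaban1985BackgroundPropagators, (3.42) p.397 (entry `∇_UG`), (3.50)–(3.52) p.400, Thm 3.14 pp.426–427 (template), (3.35)–(3.36) p.396; King1986, p.664 (pairing), Prop. 3.9 (3.73) p.665 (rate shape); Balaban1984PropagatorsII, (2.52)–(2.55) p.232 (composition of majorants)] -/
theorem sf_idef_covD_cvGlued (hL : Odd L ∧ 1 < L) (hL7 : 7 ≤ L) {a : ℝ} (ha : 0 < a) (ι : Type) [Fintype ι] [DecidableEq ι] :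
    ∃ δ w₀ R₀ D : ℝ, 0 < δ ∧ 0 < R₀ ∧
      ∀ (mv kk r : ℕ) (μ : Fin (d + 1)), 1 ≤ kk → w₀ ≤ ((L ^ mv : ℕ) : ℝ) →
      ∀ {mm : Type} [Fintype mm] [DecidableEq mm] (e : Matrix mm mm ℂ ≃L[ℝ] (ι → ℝ)), (∀ A B : Matrix mm mm ℂ, traceForm A B = e A ⬝ᵥ e B) →
      ∀ (A' : Fin (d + 1) → CvX' d L mv kk r hL → Matrix mm mm ℂ), (∀ μ x', (A' μ x')ᴴ = -A' μ x') →
      ∀ (rA : ℝ), 0 ≤ rA → (∀ μ x', ‖A' μ x'‖ ≤ rA) →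
        (∀ μ κ x', ‖A' μ (bshiftEquiv (cvM d L mv kk hL) (L ^ r * L ^ kk) κ x') - A' μ x'‖ ≤ rA * ((((L ^ r * L ^ kk : ℕ) : ℝ))⁻¹)) →
        (∀ μ κ x', ‖(A' μ (bshiftEquiv (cvM d L mv kk hL) (L ^ r * L ^ kk) κ x') - A' μ x') -
            (A' μ (bshiftEquiv (cvM d L mv kk hL) (L ^ r * L ^ kk) κ ((bshiftEquiv (cvM d L mv kk hL) (L ^ r * L ^ kk) μ).symm x')) -
              A' μ ((bshiftEquiv (cvM d L mv kk hL) (L ^ r * L ^ kk) μ).symm x'))‖ ≤ rA * ((((L ^ r * L ^ kk : ℕ) : ℝ))⁻¹) * ((((L ^ r * L ^ kk : ℕ) : ℝ))⁻¹)) →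
        2 * ((1 + Fintype.card (Fin (d + 1))) * ((3 + 2 * ((d : ℝ) + 1)) * rA)) ≤ 1 →
        (14 * Real.exp 1 * (1 + Fintype.card (Fin (d + 1))) * basisConst e * ((1 + Fintype.card (Fin (d + 1))) * ((3 + 2 * ((d : ℝ) + 1)) * rA))) * (1 + Fintype.card (Fin (d + 1) ⊕ Fin (d + 1))) ≤ R₀ →
        HasMaj (CvNorm d L mv kk hL ι) (BlockNorm.ofBlocks (unitTorusGeo L kk (cvM d L mv kk hL)) (liftBlk (cvBlk d L mv kk hL ∘ kingPrV L kk r (cvM d L mv kk hL)) ι))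
          (idef (pull (liftMap (kingPrV L kk r (cvM d L mv kk hL)) ι)) (pull (liftMap (kingPrV L kk r (cvM d L mv kk hL)) ι))
            (covD ((((L ^ r * L ^ kk : ℕ) : ℝ))⁻¹) (gaugePair (bshiftEquiv (cvM d L mv kk hL) (L ^ r * L ^ kk)) (fun μ x' => coordMat e (ContinuousLinearMap.mulLeftRight ℝ (Matrix mm mm ℂ) (NormedSpace.exp (((((L ^ r * L ^ kk : ℕ) : ℝ))⁻¹) • A' μ x')) (NormedSpace.exp (((((L ^ r * L ^ kk : ℕ) : ℝ))⁻¹) • A' μ x'))ᴴ)) (Sum.inl μ)) (bshiftEquiv (cvM d L mv kk hL) (L ^ r * L ^ kk) μ) ∘ₗ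
              cvGlued' d L mv kk r hL a ((((L ^ r * L ^ kk : ℕ) : ℝ))⁻¹) ι e (fun _ _ => (1 : Matrix mm mm ℂ)) (fun μ x' => NormedSpace.exp (((((L ^ r * L ^ kk : ℕ) : ℝ))⁻¹) • A' μ x')) (cvNL' d L mv kk r hL a ι) (fun _ => 0))
            (covD ((((L ^ kk : ℕ) : ℝ))⁻¹) (gaugePair (bshiftEquiv (cvM d L mv kk hL) (L ^ kk)) (fun μ x => coordMat e (ContinuousLinearMap.mulLeftRight ℝ (Matrix mm mm ℂ) (NormedSpace.exp (((((L ^ kk : ℕ) : ℝ))⁻¹) • gavgM (Matrix mm mm ℂ) (Fin (d + 1)) (kingPrV L kk r (cvM d L mv kk hL)) A' μ x)) (NormedSpace.exp (((((L ^ kk : ℕ) : ℝ))⁻¹) • gavgM (Matrix mm mm ℂ) (Fin (d + 1)) (kingPrV L kk r (cvM d L mv kk hL)) A' μ x))ᴴ)) (Sum.inl μ)) (bshiftEquiv (cvM d L mv kk hL) (L ^ kk) μ) ∘ₗ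
              cvGlued d L mv kk hL a ((((L ^ kk : ℕ) : ℝ))⁻¹) ι e (fun _ _ => (1 : Matrix mm mm ℂ)) (fun μ x => NormedSpace.exp (((((L ^ kk : ℕ) : ℝ))⁻¹) • gavgM (Matrix mm mm ℂ) (Fin (d + 1)) (kingPrV L kk r (cvM d L mv kk hL)) A' μ x)) (cvNL d L mv kk hL a ι) (fun _ => 0)))
          (fun y y' => D * ((((L ^ kk : ℕ) : ℝ)) ^ (-(1 / 16 : ℝ)) + (14 * Real.exp 1 * (1 + Fintype.card (Fin (d + 1))) * basisConst e * ((1 + Fintype.card (Fin (d + 1))) * ((3 + 2 * ((d : ℝ) + 1)) * rA))) * (1 + Fintype.card (Fin (d + 1) ⊕ Fin (d + 1))) * ((((L ^ kk : ℕ) : ℝ))⁻¹)) * Real.exp (-(δ * (unitTorusGeo L kk (cvM d L mv kk hL)).dist y y'))) := by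
  have hLpos : 0 < L := Nat.pos_of_ne_zero (NeZero.ne L)
  obtain ⟨δJ, wJ, RJ, DJ, hδJ, hRJ, HJ⟩ := sf_idef_jet_cvGlued (d := d) hL hL7 ha ι
  obtain ⟨δ1, w1, R1, B1, hδ1, hR1, hB1, H1⟩ := sf_jet_cvGlued_spec (d := d) hL hL7 ha ι
  obtain ⟨δ0, w0, R0, D0, hδ0, hR0, H0⟩ := sf_idef_cvGlued (d := d) hL hL7 ha ι
  obtain ⟨δP, wP, RP, BP, hδP, hRP, hBP, HP⟩ := sf_cvGlued_pair_spec (d := d) hL hL7 ha ι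
  let ρ : ℝ := min (min (δJ / 16) δ1) (min (δ0 / 16) δP)
  have hρ : 0 < ρ := lt_min (lt_min (by positivity) hδ1) (lt_min (by positivity) hδP)
  have hρJ : ρ ≤ δJ / 16 := (min_le_left _ _).trans (min_le_left _ _)
  have hρ1 : ρ ≤ δ1 := (min_le_left _ _).trans (min_le_right _ _)
  have hρ0 : ρ ≤ δ0 / 16 := (min_le_right _ _).trans (min_le_left _ _)
  have hρP : ρ ≤ δP := (min_le_right _ _).trans (min_le_right _ _)
  let Rm : ℝ := min (min RJ R1) (min R0 RP)
  have hRm : 0 < Rm := lt_min (lt_min hRJ hR1) (lt_min hR0 hRP)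
  let Dc : ℝ := (1 + Rm) * max DJ 0 + 2 * B1 + Rm * max D0 0 + BP
  refine ⟨ρ, max (max wJ w1) (max w0 wP), Rm, Dc, hρ, hRm, fun mv kk r μ hk hw₀ => ?_⟩
  intro mm _ _ e he A' hA' rA hrA h1 h2 h3 hr2 hRle
  have hwJ : wJ ≤ ((L ^ mv : ℕ) : ℝ) := ((le_max_left _ _).trans (le_max_left _ _)).trans hw₀
  have hw1 : w1 ≤ ((L ^ mv : ℕ) : ℝ) := ((le_max_right _ _).trans (le_max_left _ _)).trans hw₀
  have hw0 : w0 ≤ ((L ^ mv : ℕ) : ℝ) := ((le_max_left _ _).trans (le_max_right _ _)).trans hw₀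
  have hwP : wP ≤ ((L ^ mv : ℕ) : ℝ) := ((le_max_right _ _).trans (le_max_right _ _)).trans hw₀
  have hRleJ := hRle.trans ((min_le_left _ _).trans (min_le_left _ _))
  have hRle1 := hRle.trans ((min_le_left _ _).trans (min_le_right _ _))
  have hRle0 := hRle.trans ((min_le_right _ _).trans (min_le_left _ _))
  have hRleP := hRle.trans ((min_le_right _ _).trans (min_le_right _ _))
  -- the two spacings
  have hkpos : (0 : ℝ) < ((L ^ kk : ℕ) : ℝ) := Nat.cast_pos.mpr (pow_pos hLpos kk)
  have hrkpos : (0 : ℝ) < ((L ^ r * L ^ kk : ℕ) : ℝ) := Nat.cast_pos.mpr (Nat.mul_pos (pow_pos hLpos r) (pow_pos hLpos kk))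
  have hη : (0 : ℝ) < ((((L ^ kk : ℕ) : ℝ))⁻¹) := inv_pos.mpr hkpos
  have hη' : (0 : ℝ) < ((((L ^ r * L ^ kk : ℕ) : ℝ))⁻¹) := inv_pos.mpr hrkpos
  have hN : ((((L ^ kk : ℕ) : ℝ))⁻¹) = ((L ^ r : ℕ) : ℝ) * ((((L ^ r * L ^ kk : ℕ) : ℝ))⁻¹) := by
    have hr0 : ((L ^ r : ℕ) : ℝ) ≠ 0 := Nat.cast_ne_zero.mpr (pow_ne_zero _ (NeZero.ne L))
    rw [Nat.cast_mul]; field_simp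
  have hη1 : ((((L ^ kk : ℕ) : ℝ))⁻¹) ≤ 1 := inv_le_one_of_one_le₀ (by exact_mod_cast Nat.one_le_pow kk L hLpos)
  have hη'η : ((((L ^ r * L ^ kk : ℕ) : ℝ))⁻¹) ≤ ((((L ^ kk : ℕ) : ℝ))⁻¹) := inv_anti₀ hkpos (by exact_mod_cast Nat.le_mul_of_pos_left _ (pow_pos hLpos r))
  have hη'1 : ((((L ^ r * L ^ kk : ℕ) : ℝ))⁻¹) ≤ 1 := hη'η.trans hη1
  have hC₀ : (0 : ℝ) ≤ 2 * ((d : ℝ) + 1) := by positivity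
  have hCθ : ((2 * ((d + 1) * (L ^ r - 1)) : ℕ) : ℝ) * ((((L ^ r * L ^ kk : ℕ) : ℝ))⁻¹) ≤ 2 * ((d : ℝ) + 1) * ((((L ^ kk : ℕ) : ℝ))⁻¹) := by
    have hsub : (((L ^ r - 1 : ℕ)) : ℝ) ≤ ((L ^ r : ℕ) : ℝ) := by exact_mod_cast Nat.sub_le _ _
    have hcast : ((2 * ((d + 1) * (L ^ r - 1)) : ℕ) : ℝ) = 2 * ((d : ℝ) + 1) * (((L ^ r - 1 : ℕ)) : ℝ) := by push_cast; ring
    rw [hcast, hN]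
    calc 2 * ((d : ℝ) + 1) * (((L ^ r - 1 : ℕ)) : ℝ) * ((((L ^ r * L ^ kk : ℕ) : ℝ))⁻¹) ≤ 2 * ((d : ℝ) + 1) * ((L ^ r : ℕ) : ℝ) * ((((L ^ r * L ^ kk : ℕ) : ℝ))⁻¹) :=
          mul_le_mul_of_nonneg_right (mul_le_mul_of_nonneg_left hsub hC₀) hη'.le
      _ = 2 * ((d : ℝ) + 1) * (((L ^ r : ℕ) : ℝ) * ((((L ^ r * L ^ kk : ℕ) : ℝ))⁻¹)) := by ring
  -- King's pairing geometry and skewness in coordinates; the transporter fields are `expTrField`s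
  have hcomm := fun μ κ (x : CvX' d L mv kk r hL) => bshiftEquiv_comm (cvM d L mv kk hL) (L ^ r * L ^ kk) μ κ x
  have hconn := fun (f : CvX' d L mv kk r hL → Matrix mm mm ℂ) (β : ℝ)
      (hf : ∀ κ x, ‖f (bshiftEquiv (cvM d L mv kk hL) (L ^ r * L ^ kk) κ x) - f x‖ ≤ β) => fibre_conn_kingPrV L kk r (cvM d L mv kk hL) f β hf
  have hblk := fun μ (x' : CvX' d L mv kk r hL) => kingPrV_bshiftEquiv_pow L kk r (cvM d L mv kk hL) μ x'
  have hAm : ∀ μ x, (gavgM (Matrix mm mm ℂ) (Fin (d + 1)) (kingPrV L kk r (cvM d L mv kk hL)) A' μ x)ᴴ = -gavgM (Matrix mm mm ℂ) (Fin (d + 1)) (kingPrV L kk r (cvM d L mv kk hL)) A' μ x := gavgM_conjTranspose_of_skew (kingPrV L kk r (cvM d L mv kk hL)) hA'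
  have hA'c := fun μ x' => coordMat_adCLM_transpose_eq_neg_of_conjTranspose e he (hA' μ x')
  have hAmc := fun μ x => coordMat_adCLM_transpose_eq_neg_of_conjTranspose e he (hAm μ x)
  obtain ⟨-, hcA, -, hcA', -, hfA, -, -, -, -, -, -, -, -, -⟩ :=
    twoSidedLetters_curvCoef_one_of_meanGauge e (π := (kingPrV L kk r (cvM d L mv kk hL))) (s := bshiftEquiv (cvM d L mv kk hL) (L ^ kk))
      (s' := bshiftEquiv (cvM d L mv kk hL) (L ^ r * L ^ kk)) (N := L ^ r) (θ := ((((L ^ kk : ℕ) : ℝ))⁻¹)) (Cπ := ((2 * ((d + 1) * (L ^ r - 1)) : ℕ) : ℝ)) (C₀ := 2 * ((d : ℝ) + 1))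
      hcomm hconn hblk hη' hN hη hη1 le_rfl hC₀ hCθ hrA hr2 hA'c hAmc h1 h2 h3
  rw [curvCoefA_one, ← exp_eq_expTrField e ((((L ^ kk : ℕ) : ℝ))⁻¹) hAm] at hcA
  rw [curvCoefA_one, ← exp_eq_expTrField e ((((L ^ r * L ^ kk : ℕ) : ℝ))⁻¹) hA'] at hcA'
  rw [curvCoefA_one, curvCoefA_one, ← exp_eq_expTrField e ((((L ^ kk : ℕ) : ℝ))⁻¹) hAm, ← exp_eq_expTrField e ((((L ^ r * L ^ kk : ℕ) : ℝ))⁻¹) hA'] at hfA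
  -- the scale letter
  have hκ0 : 0 ≤ basisConst e := basisConst_nonneg e
  have hS0 : 0 ≤ (14 * Real.exp 1 * (1 + Fintype.card (Fin (d + 1))) * basisConst e * ((1 + Fintype.card (Fin (d + 1))) * ((3 + 2 * ((d : ℝ) + 1)) * rA))) := by positivity
  have hJJ1 : (1 : ℝ) ≤ (1 + Fintype.card (Fin (d + 1) ⊕ Fin (d + 1))) := le_add_of_nonneg_right (Nat.cast_nonneg _)
  have hSRm : (14 * Real.exp 1 * (1 + Fintype.card (Fin (d + 1))) * basisConst e * ((1 + Fintype.card (Fin (d + 1))) * ((3 + 2 * ((d : ℝ) + 1)) * rA))) ≤ Rm := (le_mul_of_one_le_right hS0 hJJ1).trans hRle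
  -- the transporters' rows and fit (forward direction `μ`): `R = 1 + η·a`
  have hRrow : ∀ x' i, ∑ j, |gaugePair (bshiftEquiv (cvM d L mv kk hL) (L ^ r * L ^ kk)) (fun μ x' => coordMat e (ContinuousLinearMap.mulLeftRight ℝ (Matrix mm mm ℂ) (NormedSpace.exp (((((L ^ r * L ^ kk : ℕ) : ℝ))⁻¹) • A' μ x')) (NormedSpace.exp (((((L ^ r * L ^ kk : ℕ) : ℝ))⁻¹) • A' μ x'))ᴴ)) (Sum.inl μ) x' i j| ≤ 1 + ((((L ^ r * L ^ kk : ℕ) : ℝ))⁻¹) * (14 * Real.exp 1 * (1 + Fintype.card (Fin (d + 1))) * basisConst e * ((1 + Fintype.card (Fin (d + 1))) * ((3 + 2 * ((d : ℝ) + 1)) * rA))) := fun x' i => by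
    rw [transport_inl_eq (bshiftEquiv (cvM d L mv kk hL) (L ^ r * L ^ kk)) (fun μ x' => coordMat e (ContinuousLinearMap.mulLeftRight ℝ (Matrix mm mm ℂ) (NormedSpace.exp (((((L ^ r * L ^ kk : ℕ) : ℝ))⁻¹) • A' μ x')) (NormedSpace.exp (((((L ^ r * L ^ kk : ℕ) : ℝ))⁻¹) • A' μ x'))ᴴ)) ((((L ^ r * L ^ kk : ℕ) : ℝ))⁻¹) hη'.ne' μ x']
    exact rowSum_one_add_smul_le hη'.le (hcA' (Sum.inl μ) x' i)
  have hRfit : ∀ x' i, ∑ j, |gaugePair (bshiftEquiv (cvM d L mv kk hL) (L ^ r * L ^ kk)) (fun μ x' => coordMat e (ContinuousLinearMap.mulLeftRight ℝ (Matrix mm mm ℂ) (NormedSpace.exp (((((L ^ r * L ^ kk : ℕ) : ℝ))⁻¹) • A' μ x')) (NormedSpace.exp (((((L ^ r * L ^ kk : ℕ) : ℝ))⁻¹) • A' μ x'))ᴴ)) (Sum.inl μ) x' i j - gaugePair (bshiftEquiv (cvM d L mv kk hL) (L ^ kk)) (fun μ x => coordMat e (ContinuousLinearMap.mulLeftRight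 ℝ (Matrix mm mm ℂ) (NormedSpace.exp (((((L ^ kk : ℕ) : ℝ))⁻¹) • gavgM (Matrix mm mm ℂ) (Fin (d + 1)) (kingPrV L kk r (cvM d L mv kk hL)) A' μ x)) (NormedSpace.exp (((((L ^ kk : ℕ) : ℝ))⁻¹) • gavgM (Matrix mm mm ℂ) (Fin (d + 1)) (kingPrV L kk r (cvM d L mv kk hL)) A' μ x))ᴴ)) (Sum.inl μ) ((kingPrV L kk r (cvM d L mv kk hL)) x') i j| ≤
      ((((L ^ r * L ^ kk : ℕ) : ℝ))⁻¹) * ((14 * Real.exp 1 * (1 + Fintype.card (Fin (d + 1))) * basisConst e * ((1 + Fintype.card (Fin (d + 1))) * ((3 + 2 * ((d : ℝ) + 1)) * rA))) * ((((L ^ kk : ℕ) : ℝ))⁻¹)) + |((((L ^ r * L ^ kk : ℕ) : ℝ))⁻¹) - ((((L ^ kk : ℕ) : ℝ))⁻¹)| * (14 * Real.exp 1 * (1 + Fintype.card (Fin (d + 1))) * basisConst e * ((1 + Fintype.card (Fin (d + 1))) * ((3 + 2 * ((d : ℝ) + 1)) * rA))) := fun x' i => by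
    rw [transport_inl_eq (bshiftEquiv (cvM d L mv kk hL) (L ^ r * L ^ kk)) (fun μ x' => coordMat e (ContinuousLinearMap.mulLeftRight ℝ (Matrix mm mm ℂ) (NormedSpace.exp (((((L ^ r * L ^ kk : ℕ) : ℝ))⁻¹) • A' μ x')) (NormedSpace.exp (((((L ^ r * L ^ kk : ℕ) : ℝ))⁻¹) • A' μ x'))ᴴ)) ((((L ^ r * L ^ kk : ℕ) : ℝ))⁻¹) hη'.ne' μ x', transport_inl_eq (bshiftEquiv (cvM d L mv kk hL) (L ^ kk)) (fun μ x => coordMat e (ContinuousLinearMap.mulLeftRight ℝ (Matrix mm mm ℂ) (NormedSpace.exp (((((L ^ kk : ℕ) : ℝ))⁻¹) • gavgM (Matrix mm mm ℂ) (Fin (d + 1)) (kingPrV L kk r (cvM d L mv kk hL)) A' μ x)) (NormedSpace.exp (((((L ^ kk : ℕ) : ℝ))⁻¹) • gavgM (Matrix mm mm ℂ) (Fin (d + 1)) (kingPrV L kk r (cvM d L mv kk hL)) A' μ x))ᴴ)) ((((L ^ kk : ℕ) : ℝ))⁻¹) hη.ne' μ ((kingPrV L kk r (cvM d L mv kk hL))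 x')]
    exact rowFit_one_add_smul_le hη'.le (hcA (Sum.inl μ) _ i) (hfA (Sum.inl μ) x' i)
  -- the four inputs at the common rate `ρ`
  have hd0 := unitTorusGeo_dist_nonneg L kk (cvM d L mv kk hL)
  have hexp : ∀ (c : ℝ) (y y' : Tor (cvM d L mv kk hL)), ρ ≤ c → Real.exp (-(c * (unitTorusGeo L kk (cvM d L mv kk hL)).dist y y')) ≤ Real.exp (-(ρ * (unitTorusGeo L kk (cvM d L mv kk hL)).dist y y')) :=
    fun c y y' hc => Real.exp_le_exp.mpr (neg_le_neg (mul_le_mul_of_nonneg_right hc (hd0 y y')))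
  have hSt0 : 0 ≤ (((L ^ kk : ℕ) : ℝ)) ^ (-(1 / 16 : ℝ)) + (14 * Real.exp 1 * (1 + Fintype.card (Fin (d + 1))) * basisConst e * ((1 + Fintype.card (Fin (d + 1))) * ((3 + 2 * ((d : ℝ) + 1)) * rA))) * (1 + Fintype.card (Fin (d + 1) ⊕ Fin (d + 1))) * ((((L ^ kk : ℕ) : ℝ))⁻¹) := by positivity
  have hDJ := (HJ mv kk r (Sum.inl μ) hk hwJ e he A' hA' rA hrA h1 h2 h3 hr2 hRleJ).mono fun y y' =>
    (mul_le_mul_of_nonneg_right (mul_le_mul_of_nonneg_right (le_max_left DJ 0) hSt0) (Real.exp_nonneg _)).trans (mul_le_mul_of_nonneg_left (hexp _ y y' hρJ) (mul_nonneg (le_max_right _ _) hSt0))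
  have hJ1 := (H1 mv kk r (Sum.inl μ) hk hw1 e he A' hA' rA hrA h1 h2 h3 hr2 hRle1).mono fun y y' => mul_le_mul_of_nonneg_left (hexp _ y y' hρ1) hB1.le
  have hI0 := (H0 mv kk r hk hw0 e he A' hA' rA hrA h1 h2 h3 hr2 hRle0).mono fun y y' =>
    (mul_le_mul_of_nonneg_right (mul_le_mul_of_nonneg_right (le_max_left D0 0) hSt0) (Real.exp_nonneg _)).trans (mul_le_mul_of_nonneg_left (hexp _ y y' hρ0) (mul_nonneg (le_max_right _ _) hSt0))
  have hP0 := (HP mv kk r hk hwP e he A' hA' rA hrA h1 h2 h3 hr2 hRleP).1.1.mono fun y y' => mul_le_mul_of_nonneg_left (hexp _ y y' hρP) hBP.le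
  -- the two diagonal Leibniz letters (n15-b `hasMaj_idef_mmulOp_comp_left`)
  have hT1 := hasMaj_idef_mmulOp_comp_left (g := unitTorusGeo L kk (cvM d L mv kk hL)) (cvBlk d L mv kk hL) (kingPrV L kk r (cvM d L mv kk hL)) (by positivity) (by positivity) hRrow hRfit hDJ hJ1
  have hT2 := hasMaj_idef_mmulOp_comp_left (g := unitTorusGeo L kk (cvM d L mv kk hL)) (cvBlk d L mv kk hL) (kingPrV L kk r (cvM d L mv kk hL)) hS0 (by positivity)
    (fun x' i => hcA' (Sum.inl μ) x' i) (fun x' i => hfA (Sum.inl μ) x' i) hI0 hP0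
  -- `D^η_R = M_R∘∇ + M_a`, both grids; assemble
  rw [covD_transport_inl (bshiftEquiv (cvM d L mv kk hL) (L ^ r * L ^ kk)) ((((L ^ r * L ^ kk : ℕ) : ℝ))⁻¹) (gaugePair (bshiftEquiv (cvM d L mv kk hL) (L ^ r * L ^ kk)) (fun μ x' => coordMat e (ContinuousLinearMap.mulLeftRight ℝ (Matrix mm mm ℂ) (NormedSpace.exp (((((L ^ r * L ^ kk : ℕ) : ℝ))⁻¹) • A' μ x')) (NormedSpace.exp (((((L ^ r * L ^ kk : ℕ) : ℝ))⁻¹) • A' μ x'))ᴴ))) μ, covD_transport_inl (bshiftEquiv (cvM d L mv kk hL) (L ^ kk)) ((((L ^ kk : ℕ) : ℝ))⁻¹) (gaugePair (bshiftEquiv (cvM d L mv kk hL) (L ^ kk)) (fun μ x => coordMat e (ContinuousLinearMap.mulLeftRight ℝ (Matrix mm mm ℂ) (NormedSpace.exp (((((L ^ kk : ℕ) : ℝ))⁻¹) • gavgM (Matrix mm mm ℂ) (Fin (d + 1)) (kingPrV L kk r (cvM d L mv kk hL)) A' μ x)) (NormedSpace.exp (((((L ^ kk : ℕ) : ℝ))⁻¹)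 • gavgM (Matrix mm mm ℂ) (Fin (d + 1)) (kingPrV L kk r (cvM d L mv kk hL)) A' μ x))ᴴ))) μ, LinearMap.add_comp, LinearMap.add_comp,
    LinearMap.comp_assoc, LinearMap.comp_assoc, idef_add]
  refine (hT1.add hT2).mono fun y y' => ?_
  -- the scalar bookkeeping
  have hE0 : 0 ≤ Real.exp (-(ρ * (unitTorusGeo L kk (cvM d L mv kk hL)).dist y y')) := Real.exp_nonneg _
  have hSη : (14 * Real.exp 1 * (1 + Fintype.card (Fin (d + 1))) * basisConst e * ((1 + Fintype.card (Fin (d + 1))) * ((3 + 2 * ((d : ℝ) + 1)) * rA))) * ((((L ^ kk : ℕ) : ℝ))⁻¹) ≤ (((L ^ kk : ℕ) : ℝ)) ^ (-(1 / 16 : ℝ)) + (14 * Real.exp 1 * (1 + Fintype.card (Fin (d + 1))) * basisConst e * ((1 + Fintype.card (Fin (d + 1))) * ((3 + 2 * ((d : ℝ) + 1)) * rA))) * (1 + Fintype.card (Fin (d + 1) ⊕ Fin (d + 1))) * ((((L ^ kk : ℕ) : ℝ))⁻¹) := by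
    have h1 : (14 * Real.exp 1 * (1 + Fintype.card (Fin (d + 1))) * basisConst e * ((1 + Fintype.card (Fin (d + 1))) * ((3 + 2 * ((d : ℝ) + 1)) * rA))) * ((((L ^ kk : ℕ) : ℝ))⁻¹) ≤ (14 * Real.exp 1 * (1 + Fintype.card (Fin (d + 1))) * basisConst e * ((1 + Fintype.card (Fin (d + 1))) * ((3 + 2 * ((d : ℝ) + 1)) * rA))) * (1 + Fintype.card (Fin (d + 1) ⊕ Fin (d + 1))) * ((((L ^ kk : ℕ) : ℝ))⁻¹) := by
      rw [mul_assoc ((14 * Real.exp 1 * (1 + Fintype.card (Fin (d + 1))) * basisConst e * ((1 + Fintype.card (Fin (d + 1))) * ((3 + 2 * ((d : ℝ) + 1)) * rA)))) ((1 + Fintype.card (Fin (d + 1) ⊕ Fin (d + 1))))]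
      exact mul_le_mul_of_nonneg_left (le_mul_of_one_le_left hη.le hJJ1) hS0
    have h2 : 0 ≤ (((L ^ kk : ℕ) : ℝ)) ^ (-(1 / 16 : ℝ)) := by positivity
    linarith only [h1, h2]
  have hoR : ((((L ^ r * L ^ kk : ℕ) : ℝ))⁻¹) * ((14 * Real.exp 1 * (1 + Fintype.card (Fin (d + 1))) * basisConst e * ((1 + Fintype.card (Fin (d + 1))) * ((3 + 2 * ((d : ℝ) + 1)) * rA))) * ((((L ^ kk : ℕ) : ℝ))⁻¹)) + |((((L ^ r * L ^ kk : ℕ) : ℝ))⁻¹) - ((((L ^ kk : ℕ) : ℝ))⁻¹)| * (14 * Real.exp 1 * (1 + Fintype.card (Fin (d + 1))) * basisConst e * ((1 + Fintype.card (Fin (d + 1))) * ((3 + 2 * ((d : ℝ) + 1)) * rA))) ≤ 2 * ((14 * Real.exp 1 * (1 + Fintype.card (Fin (d + 1))) * basisConst e * ((1 + Fintype.card (Fin (d + 1))) * ((3 + 2 * ((d : ℝ) + 1)) * rA))) * ((((L ^ kk : ℕ) : ℝ))⁻¹)) := by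
    have habs : |((((L ^ r * L ^ kk : ℕ) : ℝ))⁻¹) - ((((L ^ kk : ℕ) : ℝ))⁻¹)| ≤ ((((L ^ kk : ℕ) : ℝ))⁻¹) := by
      rw [abs_sub_comm, abs_of_nonneg (sub_nonneg.mpr hη'η)]; linarith only [hη'.le]
    have h1 : ((((L ^ r * L ^ kk : ℕ) : ℝ))⁻¹) * ((14 * Real.exp 1 * (1 + Fintype.card (Fin (d + 1))) * basisConst e * ((1 + Fintype.card (Fin (d + 1))) * ((3 + 2 * ((d : ℝ) + 1)) * rA))) * ((((L ^ kk : ℕ) : ℝ))⁻¹)) ≤ 1 * ((14 * Real.exp 1 * (1 + Fintype.card (Fin (d + 1))) * basisConst e * ((1 + Fintype.card (Fin (d + 1))) * ((3 + 2 * ((d : ℝ) + 1)) * rA))) * ((((L ^ kk : ℕ) : ℝ))⁻¹)) := mul_le_mul_of_nonneg_right hη'1 (mul_nonneg hS0 hη.le)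
    have h2 : |((((L ^ r * L ^ kk : ℕ) : ℝ))⁻¹) - ((((L ^ kk : ℕ) : ℝ))⁻¹)| * (14 * Real.exp 1 * (1 + Fintype.card (Fin (d + 1))) * basisConst e * ((1 + Fintype.card (Fin (d + 1))) * ((3 + 2 * ((d : ℝ) + 1)) * rA))) ≤ ((((L ^ kk : ℕ) : ℝ))⁻¹) * (14 * Real.exp 1 * (1 + Fintype.card (Fin (d + 1))) * basisConst e * ((1 + Fintype.card (Fin (d + 1))) * ((3 + 2 * ((d : ℝ) + 1)) * rA))) := mul_le_mul_of_nonneg_right habs hS0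
    nlinarith only [h1, h2]
  have hA1 : (1 + ((((L ^ r * L ^ kk : ℕ) : ℝ))⁻¹) * (14 * Real.exp 1 * (1 + Fintype.card (Fin (d + 1))) * basisConst e * ((1 + Fintype.card (Fin (d + 1))) * ((3 + 2 * ((d : ℝ) + 1)) * rA)))) * (max DJ 0 * ((((L ^ kk : ℕ) : ℝ)) ^ (-(1 / 16 : ℝ)) + (14 * Real.exp 1 * (1 + Fintype.card (Fin (d + 1))) * basisConst e * ((1 + Fintype.card (Fin (d + 1))) * ((3 + 2 * ((d : ℝ) + 1)) * rA))) * (1 + Fintype.card (Fin (d + 1) ⊕ Fin (d + 1))) * ((((L ^ kk : ℕ) : ℝ))⁻¹))) ≤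
      (1 + Rm) * max DJ 0 * ((((L ^ kk : ℕ) : ℝ)) ^ (-(1 / 16 : ℝ)) + (14 * Real.exp 1 * (1 + Fintype.card (Fin (d + 1))) * basisConst e * ((1 + Fintype.card (Fin (d + 1))) * ((3 + 2 * ((d : ℝ) + 1)) * rA))) * (1 + Fintype.card (Fin (d + 1) ⊕ Fin (d + 1))) * ((((L ^ kk : ℕ) : ℝ))⁻¹)) := by
    rw [mul_assoc (1 + Rm)]
    refine mul_le_mul_of_nonneg_right ?_ (mul_nonneg (le_max_right _ _) hSt0)
    have : ((((L ^ r * L ^ kk : ℕ) : ℝ))⁻¹) * (14 * Real.exp 1 * (1 + Fintype.card (Fin (d + 1))) * basisConst e * ((1 + Fintype.card (Fin (d + 1))) * ((3 + 2 * ((d : ℝ) + 1)) * rA))) ≤ 1 * Rm := mul_le_mul hη'1 hSRm hS0 zero_le_one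
    linarith only [this]
  have hA2 : (((((L ^ r * L ^ kk : ℕ) : ℝ))⁻¹) * ((14 * Real.exp 1 * (1 + Fintype.card (Fin (d + 1))) * basisConst e * ((1 + Fintype.card (Fin (d + 1))) * ((3 + 2 * ((d : ℝ) + 1)) * rA))) * ((((L ^ kk : ℕ) : ℝ))⁻¹)) + |((((L ^ r * L ^ kk : ℕ) : ℝ))⁻¹) - ((((L ^ kk : ℕ) : ℝ))⁻¹)| * (14 * Real.exp 1 * (1 + Fintype.card (Fin (d + 1))) * basisConst e * ((1 + Fintype.card (Fin (d + 1))) * ((3 + 2 * ((d : ℝ) + 1)) * rA)))) * B1 ≤ 2 * B1 * ((((L ^ kk : ℕ) : ℝ)) ^ (-(1 / 16 : ℝ)) + (14 * Real.exp 1 * (1 + Fintype.card (Fin (d + 1))) * basisConst e * ((1 + Fintype.card (Fin (d + 1))) * ((3 + 2 * ((d : ℝ) + 1)) * rA))) * (1 + Fintype.card (Fin (d + 1) ⊕ Fin (d + 1))) * ((((L ^ kk : ℕ) : ℝ))⁻¹)) := by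
    calc (((((L ^ r * L ^ kk : ℕ) : ℝ))⁻¹) * ((14 * Real.exp 1 * (1 + Fintype.card (Fin (d + 1))) * basisConst e * ((1 + Fintype.card (Fin (d + 1))) * ((3 + 2 * ((d : ℝ) + 1)) * rA))) * ((((L ^ kk : ℕ) : ℝ))⁻¹)) + |((((L ^ r * L ^ kk : ℕ) : ℝ))⁻¹) - ((((L ^ kk : ℕ) : ℝ))⁻¹)| * (14 * Real.exp 1 * (1 + Fintype.card (Fin (d + 1))) * basisConst e * ((1 + Fintype.card (Fin (d + 1))) * ((3 + 2 * ((d : ℝ) + 1)) * rA)))) * B1 ≤ 2 * ((14 * Real.exp 1 * (1 + Fintype.card (Fin (d + 1))) * basisConst e * ((1 + Fintype.card (Fin (d + 1))) * ((3 + 2 * ((d : ℝ) + 1)) * rA))) * ((((L ^ kk : ℕ) : ℝ))⁻¹)) * B1 := mul_le_mul_of_nonneg_right hoR hB1.le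
      _ ≤ 2 * ((((L ^ kk : ℕ) : ℝ)) ^ (-(1 / 16 : ℝ)) + (14 * Real.exp 1 * (1 + Fintype.card (Fin (d + 1))) * basisConst e * ((1 + Fintype.card (Fin (d + 1))) * ((3 + 2 * ((d : ℝ) + 1)) * rA))) * (1 + Fintype.card (Fin (d + 1) ⊕ Fin (d + 1))) * ((((L ^ kk : ℕ) : ℝ))⁻¹)) * B1 := mul_le_mul_of_nonneg_right (by linarith only [hSη]) hB1.le
      _ = 2 * B1 * ((((L ^ kk : ℕ) : ℝ)) ^ (-(1 / 16 : ℝ)) + (14 * Real.exp 1 * (1 + Fintype.card (Fin (d + 1))) * basisConst e * ((1 + Fintype.card (Fin (d + 1))) * ((3 + 2 * ((d : ℝ) + 1)) * rA))) * (1 + Fintype.card (Fin (d + 1) ⊕ Fin (d + 1))) * ((((L ^ kk : ℕ) : ℝ))⁻¹)) := by ring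
  have hA3 : (14 * Real.exp 1 * (1 + Fintype.card (Fin (d + 1))) * basisConst e * ((1 + Fintype.card (Fin (d + 1))) * ((3 + 2 * ((d : ℝ) + 1)) * rA))) * (max D0 0 * ((((L ^ kk : ℕ) : ℝ)) ^ (-(1 / 16 : ℝ)) + (14 * Real.exp 1 * (1 + Fintype.card (Fin (d + 1))) * basisConst e * ((1 + Fintype.card (Fin (d + 1))) * ((3 + 2 * ((d : ℝ) + 1)) * rA))) * (1 + Fintype.card (Fin (d + 1) ⊕ Fin (d + 1))) * ((((L ^ kk : ℕ) : ℝ))⁻¹))) ≤ Rm * max D0 0 * ((((L ^ kk : ℕ) : ℝ)) ^ (-(1 / 16 : ℝ)) + (14 * Real.exp 1 * (1 + Fintype.card (Fin (d + 1))) * basisConst e * ((1 + Fintype.card (Fin (d + 1))) * ((3 + 2 * ((d : ℝ) + 1)) * rA))) * (1 + Fintype.card (Fin (d + 1) ⊕ Fin (d + 1))) * ((((L ^ kk : ℕ) : ℝ))⁻¹)) := by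
    rw [mul_assoc Rm]; exact mul_le_mul_of_nonneg_right hSRm (mul_nonneg (le_max_right _ _) hSt0)
  have hA4 : (14 * Real.exp 1 * (1 + Fintype.card (Fin (d + 1))) * basisConst e * ((1 + Fintype.card (Fin (d + 1))) * ((3 + 2 * ((d : ℝ) + 1)) * rA))) * ((((L ^ kk : ℕ) : ℝ))⁻¹) * BP ≤ BP * ((((L ^ kk : ℕ) : ℝ)) ^ (-(1 / 16 : ℝ)) + (14 * Real.exp 1 * (1 + Fintype.card (Fin (d + 1))) * basisConst e * ((1 + Fintype.card (Fin (d + 1))) * ((3 + 2 * ((d : ℝ) + 1)) * rA))) * (1 + Fintype.card (Fin (d + 1) ⊕ Fin (d + 1))) * ((((L ^ kk : ℕ) : ℝ))⁻¹)) := by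
    rw [mul_comm BP]; exact mul_le_mul_of_nonneg_right hSη hBP.le
  have hsum : (1 + ((((L ^ r * L ^ kk : ℕ) : ℝ))⁻¹) * (14 * Real.exp 1 * (1 + Fintype.card (Fin (d + 1))) * basisConst e * ((1 + Fintype.card (Fin (d + 1))) * ((3 + 2 * ((d : ℝ) + 1)) * rA)))) * (max DJ 0 * ((((L ^ kk : ℕ) : ℝ)) ^ (-(1 / 16 : ℝ)) + (14 * Real.exp 1 * (1 + Fintype.card (Fin (d + 1))) * basisConst e * ((1 + Fintype.card (Fin (d + 1))) * ((3 + 2 * ((d : ℝ) + 1)) * rA))) * (1 + Fintype.card (Fin (d + 1) ⊕ Fin (d + 1))) * ((((L ^ kk : ℕ) : ℝ))⁻¹))) + (((((L ^ r * L ^ kk : ℕ) : ℝ))⁻¹) * ((14 * Real.exp 1 * (1 + Fintype.card (Fin (d + 1))) * basisConst e * ((1 + Fintype.card (Fin (d + 1))) * ((3 + 2 * ((d : ℝ) + 1)) * rA))) * ((((L ^ kk : ℕ) : ℝ))⁻¹)) + |((((L ^ r * L ^ kk : ℕ) : ℝ))⁻¹) - ((((L ^ kk : ℕ) : ℝ))⁻¹)|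 * (14 * Real.exp 1 * (1 + Fintype.card (Fin (d + 1))) * basisConst e * ((1 + Fintype.card (Fin (d + 1))) * ((3 + 2 * ((d : ℝ) + 1)) * rA)))) * B1 +
      ((14 * Real.exp 1 * (1 + Fintype.card (Fin (d + 1))) * basisConst e * ((1 + Fintype.card (Fin (d + 1))) * ((3 + 2 * ((d : ℝ) + 1)) * rA))) * (max D0 0 * ((((L ^ kk : ℕ) : ℝ)) ^ (-(1 / 16 : ℝ)) + (14 * Real.exp 1 * (1 + Fintype.card (Fin (d + 1))) * basisConst e * ((1 + Fintype.card (Fin (d + 1))) * ((3 + 2 * ((d : ℝ) + 1)) * rA))) * (1 + Fintype.card (Fin (d + 1) ⊕ Fin (d + 1))) * ((((L ^ kk : ℕ) : ℝ))⁻¹))) + (14 * Real.exp 1 * (1 + Fintype.card (Fin (d + 1))) * basisConst e * ((1 + Fintype.card (Fin (d + 1))) * ((3 + 2 * ((d : ℝ) + 1)) * rA))) * ((((L ^ kk : ℕ) : ℝ))⁻¹) * BP) ≤ Dc * ((((L ^ kk : ℕ) : ℝ)) ^ (-(1 / 16 : ℝ)) + (14 * Real.exp 1 * (1 + Fintype.card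 (Fin (d + 1))) * basisConst e * ((1 + Fintype.card (Fin (d + 1))) * ((3 + 2 * ((d : ℝ) + 1)) * rA))) * (1 + Fintype.card (Fin (d + 1) ⊕ Fin (d + 1))) * ((((L ^ kk : ℕ) : ℝ))⁻¹)) := by
    have e : Dc * ((((L ^ kk : ℕ) : ℝ)) ^ (-(1 / 16 : ℝ)) + (14 * Real.exp 1 * (1 + Fintype.card (Fin (d + 1))) * basisConst e * ((1 + Fintype.card (Fin (d + 1))) * ((3 + 2 * ((d : ℝ) + 1)) * rA))) * (1 + Fintype.card (Fin (d + 1) ⊕ Fin (d + 1))) * ((((L ^ kk : ℕ) : ℝ))⁻¹)) = (1 + Rm) * max DJ 0 * ((((L ^ kk : ℕ) : ℝ)) ^ (-(1 / 16 : ℝ)) + (14 * Real.exp 1 * (1 + Fintype.card (Fin (d + 1))) * basisConst e * ((1 + Fintype.card (Fin (d + 1))) * ((3 + 2 * ((d : ℝ) + 1)) * rA))) * (1 + Fintype.card (Fin (d + 1) ⊕ Fin (d + 1))) * ((((L ^ kk : ℕ) : ℝ))⁻¹)) +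
        2 * B1 * ((((L ^ kk : ℕ) : ℝ)) ^ (-(1 / 16 : ℝ)) + (14 * Real.exp 1 * (1 + Fintype.card (Fin (d + 1))) * basisConst e * ((1 + Fintype.card (Fin (d + 1))) * ((3 + 2 * ((d : ℝ) + 1)) * rA))) * (1 + Fintype.card (Fin (d + 1) ⊕ Fin (d + 1))) * ((((L ^ kk : ℕ) : ℝ))⁻¹)) + (Rm * max D0 0 * ((((L ^ kk : ℕ) : ℝ)) ^ (-(1 / 16 : ℝ)) + (14 * Real.exp 1 * (1 + Fintype.card (Fin (d + 1))) * basisConst e * ((1 + Fintype.card (Fin (d + 1))) * ((3 + 2 * ((d : ℝ) + 1)) * rA))) * (1 + Fintype.card (Fin (d + 1) ⊕ Fin (d + 1))) * ((((L ^ kk : ℕ) : ℝ))⁻¹)) + BP * ((((L ^ kk : ℕ) : ℝ)) ^ (-(1 / 16 : ℝ)) + (14 * Real.exp 1 * (1 + Fintype.card (Fin (d + 1))) * basisConst e * ((1 + Fintype.card (Fin (d + 1))) * ((3 + 2 * ((d : ℝ) + 1)) * rA))) * (1 + Fintype.card (Fin (d + 1) ⊕ Fin (d + 1))) * ((((L ^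 kk : ℕ) : ℝ))⁻¹))) := by ring
    rw [e]; linarith only [hA1, hA2, hA3, hA4]
  calc ((1 + ((((L ^ r * L ^ kk : ℕ) : ℝ))⁻¹) * (14 * Real.exp 1 * (1 + Fintype.card (Fin (d + 1))) * basisConst e * ((1 + Fintype.card (Fin (d + 1))) * ((3 + 2 * ((d : ℝ) + 1)) * rA)))) * (max DJ 0 * ((((L ^ kk : ℕ) : ℝ)) ^ (-(1 / 16 : ℝ)) + (14 * Real.exp 1 * (1 + Fintype.card (Fin (d + 1))) * basisConst e * ((1 + Fintype.card (Fin (d + 1))) * ((3 + 2 * ((d : ℝ) + 1)) * rA))) * (1 + Fintype.card (Fin (d + 1) ⊕ Fin (d + 1))) * ((((L ^ kk : ℕ) : ℝ))⁻¹))) + (((((L ^ r * L ^ kk : ℕ) : ℝ))⁻¹) * ((14 * Real.exp 1 * (1 + Fintype.card (Fin (d + 1))) * basisConst e * ((1 + Fintype.card (Fin (d + 1))) * ((3 + 2 * ((d : ℝ) + 1)) * rA))) * ((((L ^ kk : ℕ) : ℝ))⁻¹)) + |((((L ^ r * L ^ kk : ℕ) : ℝ))⁻¹) - ((((L ^ kk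 : ℕ) : ℝ))⁻¹)| * (14 * Real.exp 1 * (1 + Fintype.card (Fin (d + 1))) * basisConst e * ((1 + Fintype.card (Fin (d + 1))) * ((3 + 2 * ((d : ℝ) + 1)) * rA)))) * B1) *
          Real.exp (-(ρ * (unitTorusGeo L kk (cvM d L mv kk hL)).dist y y')) +
        ((14 * Real.exp 1 * (1 + Fintype.card (Fin (d + 1))) * basisConst e * ((1 + Fintype.card (Fin (d + 1))) * ((3 + 2 * ((d : ℝ) + 1)) * rA))) * (max D0 0 * ((((L ^ kk : ℕ) : ℝ)) ^ (-(1 / 16 : ℝ)) + (14 * Real.exp 1 * (1 + Fintype.card (Fin (d + 1))) * basisConst e * ((1 + Fintype.card (Fin (d + 1))) * ((3 + 2 * ((d : ℝ) + 1)) * rA))) * (1 + Fintype.card (Fin (d + 1) ⊕ Fin (d + 1))) * ((((L ^ kk : ℕ) : ℝ))⁻¹))) + (14 * Real.exp 1 * (1 + Fintype.card (Fin (d + 1))) * basisConst e * ((1 + Fintype.card (Fin (d + 1))) * ((3 + 2 * ((d : ℝ) + 1)) * rA))) * ((((L ^ kk : ℕ) : ℝ))⁻¹) * BP) * Real.exp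 (-(ρ * (unitTorusGeo L kk (cvM d L mv kk hL)).dist y y'))
      = ((1 + ((((L ^ r * L ^ kk : ℕ) : ℝ))⁻¹) * (14 * Real.exp 1 * (1 + Fintype.card (Fin (d + 1))) * basisConst e * ((1 + Fintype.card (Fin (d + 1))) * ((3 + 2 * ((d : ℝ) + 1)) * rA)))) * (max DJ 0 * ((((L ^ kk : ℕ) : ℝ)) ^ (-(1 / 16 : ℝ)) + (14 * Real.exp 1 * (1 + Fintype.card (Fin (d + 1))) * basisConst e * ((1 + Fintype.card (Fin (d + 1))) * ((3 + 2 * ((d : ℝ) + 1)) * rA))) * (1 + Fintype.card (Fin (d + 1) ⊕ Fin (d + 1))) * ((((L ^ kk : ℕ) : ℝ))⁻¹))) + (((((L ^ r * L ^ kk : ℕ) : ℝ))⁻¹) * ((14 * Real.exp 1 * (1 + Fintype.card (Fin (d + 1))) * basisConst e * ((1 + Fintype.card (Fin (d + 1))) * ((3 + 2 * ((d : ℝ) + 1)) * rA))) * ((((L ^ kk : ℕ) : ℝ))⁻¹)) + |((((L ^ r * L ^ kk : ℕ) : ℝ))⁻¹) - ((((L ^ kk : ℕ) : ℝ))⁻¹)|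 * (14 * Real.exp 1 * (1 + Fintype.card (Fin (d + 1))) * basisConst e * ((1 + Fintype.card (Fin (d + 1))) * ((3 + 2 * ((d : ℝ) + 1)) * rA)))) * B1 +
          ((14 * Real.exp 1 * (1 + Fintype.card (Fin (d + 1))) * basisConst e * ((1 + Fintype.card (Fin (d + 1))) * ((3 + 2 * ((d : ℝ) + 1)) * rA))) * (max D0 0 * ((((L ^ kk : ℕ) : ℝ)) ^ (-(1 / 16 : ℝ)) + (14 * Real.exp 1 * (1 + Fintype.card (Fin (d + 1))) * basisConst e * ((1 + Fintype.card (Fin (d + 1))) * ((3 + 2 * ((d : ℝ) + 1)) * rA))) * (1 + Fintype.card (Fin (d + 1) ⊕ Fin (d + 1))) * ((((L ^ kk : ℕ) : ℝ))⁻¹))) + (14 * Real.exp 1 * (1 + Fintype.card (Fin (d + 1))) * basisConst e * ((1 + Fintype.card (Fin (d + 1))) * ((3 + 2 * ((d : ℝ) + 1)) * rA))) * ((((L ^ kk : ℕ) : ℝ))⁻¹) * BP)) * Real.exp (-(ρ * (unitTorusGeo L kk (cvM d L mv kk hL)).dist y y')) := by ring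
    _ ≤ Dc * ((((L ^ kk : ℕ) : ℝ)) ^ (-(1 / 16 : ℝ)) + (14 * Real.exp 1 * (1 + Fintype.card (Fin (d + 1))) * basisConst e * ((1 + Fintype.card (Fin (d + 1))) * ((3 + 2 * ((d : ℝ) + 1)) * rA))) * (1 + Fintype.card (Fin (d + 1) ⊕ Fin (d + 1))) * ((((L ^ kk : ℕ) : ℝ))⁻¹)) * Real.exp (-(ρ * (unitTorusGeo L kk (cvM d L mv kk hL)).dist y y')) := mul_le_mul_of_nonneg_right hsum hE0

end Defect

end Summit.QuantumFields.YangMills.BalabanUVNodes.N15.Gluing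

end
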